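import Summits.CriticalPhenomena.CardyFormulaZ2.Theorems.CardySelfDualSegmentUniformMarginalitySandwichGlue
import Summits.CriticalPhenomena.CardyFormulaZ2.Theorems.CardySelfDualSegmentUniformMarginalityTransportGlue

/-!
# Transport at one parameter (line `Sketch`, crux `UniformMarginality`, stmt-CriticalPhenomena-5472)

The chain of skeleton v6 — fixed-parameter domain continuity (B₂a″) + the crux on rectilinear domains
(B₁) ⟹ local uniform rectilinear sandwiches ⟹ (transport) the crux for every conformal rectangle — is
POINTWISE IN THE PARAMETER `t₀`. This file proves the parameter-localised chain,

* `integratedBoundAtParam_of_fixedDomainContinuity` : for a fixed `t₀ ∈ [0,1]`,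
  (B₂a″ at `t₀`) → (B₁ at `t₀`, i.e. the modulus of continuity at `t₀` uniform in the mesh for every
  RECTILINEAR conformal rectangle) → the same modulus at `t₀` for EVERY conformal rectangle,

to be specialised at the base point `t₀ = 0` with the landed `fixedDomainContinuity_zero` (p116559:
Smirnov + Radó) in the companion file `…BasePointTransport.lean` (the crux AT the Smirnov point for
every conformal rectangle from the same statement for rectilinear ones, unconditionally).

Ingredients (all landed): `stub_mixedApproximants` (geometry, p114647), `Pext_mono_of_nested`
(p115057), `integratedBoundAt_of_le_mesh` (large-mesh modulus, p111792).
-/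

noncomputable section

namespace Summit.CriticalPhenomena.CardyFormulaZ2.Cruxes.UniformMarginality.HeatFlow

open MeasureTheory Literature.Probability.Percolation Literature.Probability.LatticeModels
  Literature.Probability.RandomPlanarGeometry

/-- **Transport at one parameter.** Fix `t₀ ∈ [0,1]`. If (i) crude crossing probabilities AT `t₀` are
continuous in the marked domain in the fixed-parameter sense of (B₂a″) (every `ε₀`-close rectilinear
`Q` is `ε`-close to `R` below a threshold `δ₀(Q)`), and (ii) every RECTILINEAR conformal rectangle has
a modulus of continuity of `t ↦ P_t(·,δ)` at `t₀` uniform in the mesh, then EVERY conformal rectangle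
has such a modulus at `t₀`. Proof: sandwich `R' ≤ R ≤ R''` (`stub_mixedApproximants`,
`Pext_mono_of_nested`), `P_t(R) − P_{t₀}(R) ≤ [P_t(R'') − P_{t₀}(R'')] + [P_{t₀}(R'') − P_{t₀}(R)]` and
symmetrically from below for `δ` below the thresholds; `integratedBoundAt_of_le_mesh` above them. -/
theorem integratedBoundAtParam_of_fixedDomainContinuity :
    ∀ t₀ ∈ Set.Icc (0 : ℝ) 1,
      (∀ (R : ConformalRectangle) (ε : ℝ), 0 < ε → ∃ ε₀ > 0, ∀ Q : ConformalRectangle,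
        (∃ S : Finset (ℂ × ℂ), (∀ p ∈ S, p.1.re = p.2.re ∨ p.1.im = p.2.im) ∧
          frontier Q.carrier ⊆ ⋃ p ∈ S, segment ℝ p.1 p.2) →
        (∀ u : ℝ, dist (Q.boundary u) (R.boundary u) ≤ ε₀) → (∀ i : Fin 4, |Q.mark i - R.mark i| ≤ ε₀) →
        ∃ δ₀ > 0, ∀ δ : ℝ, 0 < δ → δ < δ₀ → |Pext Q δ t₀ - Pext R δ t₀| ≤ ε) →
      (∀ R : ConformalRectangle,
        (∃ S : Finset (ℂ × ℂ), (∀ p ∈ S, p.1.re = p.2.re ∨ p.1.im = p.2.im) ∧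
          frontier R.carrier ⊆ ⋃ p ∈ S, segment ℝ p.1 p.2) →
        ∀ ε > 0, ∃ η > 0, ∀ δ : ℝ, 0 < δ → ∀ t ∈ Set.Icc (0 : ℝ) 1, |t - t₀| < η →
          |Pext R δ t - Pext R δ t₀| < ε) →
      ∀ R : ConformalRectangle, ∀ ε > 0, ∃ η > 0, ∀ δ : ℝ, 0 < δ → ∀ t ∈ Set.Icc (0 : ℝ) 1,
        |t - t₀| < η → |Pext R δ t - Pext R δ t₀| < ε := by
  intro t₀ ht₀ hDC hB R ε hε
  have hε4 : 0 < ε / 4 := by positivity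
  obtain ⟨ε₀, hε₀, hclose⟩ := hDC R (ε / 4) hε4
  obtain ⟨R', R'', hS', hS'', hb', hm', hb'', hm'', δ₁, hδ₁, hnest⟩ :=
    stub_mixedApproximants R ε₀ hε₀
  obtain ⟨δ', hδ', h'⟩ := hclose R' hS' hb' hm'
  obtain ⟨δ'', hδ'', h''⟩ := hclose R'' hS'' hb'' hm''
  obtain ⟨η', hη', hB'⟩ := hB R' hS' (ε / 4) hε4
  obtain ⟨η'', hη'', hB''⟩ := hB R'' hS'' (ε / 4) hε4
  -- the large-mesh modulus above the threshold `δ* = min δ₁ (min δ' δ'')`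
  have hδstar : 0 < min δ₁ (min δ' δ'') := lt_min hδ₁ (lt_min hδ' hδ'')
  obtain ⟨η₁, hη₁, hlarge⟩ := integratedBoundAt_of_le_mesh R hδstar hε
  refine ⟨min η₁ (min η' η''), lt_min hη₁ (lt_min hη' hη''), ?_⟩
  intro δ hδ t ht htt₀
  have hη₁lt : |t - t₀| < η₁ := htt₀.trans_le (min_le_left _ _)
  have hη'lt : |t - t₀| < η' := htt₀.trans_le ((min_le_right _ _).trans (min_le_left _ _))
  have hη''lt : |t - t₀| < η'' := htt₀.trans_le ((min_le_right _ _).trans (min_le_right _ _))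
  by_cases hsmall : δ < min δ₁ (min δ' δ'')
  · have hδ₁' : δ < δ₁ := hsmall.trans_le (min_le_left _ _)
    have hδ'lt : δ < δ' := hsmall.trans_le ((min_le_right _ _).trans (min_le_left _ _))
    have hδ''lt : δ < δ'' := hsmall.trans_le ((min_le_right _ _).trans (min_le_right _ _))
    have hlo : ∀ s : ℝ, Pext R' δ s ≤ Pext R δ s := fun s =>
      Pext_mono_of_nested (fun ω hω hωc => (hnest δ hδ hδ₁' ω hω).1 hωc) s
    have hhi : ∀ s : ℝ, Pext R δ s ≤ Pext R'' δ s := fun s =>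
      Pext_mono_of_nested (fun ω hω hωc => (hnest δ hδ hδ₁' ω hω).2 hωc) s
    have h1 := h' δ hδ hδ'lt            -- |P_{t₀}(R') − P_{t₀}(R)| ≤ ε/4
    have h2 := h'' δ hδ hδ''lt          -- |P_{t₀}(R'') − P_{t₀}(R)| ≤ ε/4
    have h3 := hB' δ hδ t ht hη'lt      -- |P_t(R') − P_{t₀}(R')| < ε/4
    have h4 := hB'' δ hδ t ht hη''lt    -- |P_t(R'') − P_{t₀}(R'')| < ε/4
    have hlo_t := hlo t
    have hhi_t := hhi t
    rw [abs_le] at h1 h2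
    rw [abs_lt] at h3 h4 ⊢
    constructor
    · linarith [h1.1, h3.1]
    · linarith [h2.2, h4.2]
  · exact hlarge δ (le_of_not_gt hsmall) t ht t₀ ht₀ hη₁lt

end Summit.CriticalPhenomena.CardyFormulaZ2.Cruxes.UniformMarginality.HeatFlow

end
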